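import Summits.NavierStokesRegularity.FluidComputer.RiccatiInequalityGen
import Summits.NavierStokesRegularity.FluidComputer.HomSobolevSuperLadder
import HarnessLib

/-!
# Fluid computer — support: the dyadic rows of EVERY order along a blow-up (`Y_κ = ∑_j 2^{κj} ‖Δ̇_j u‖₂²`, `κ ≥ 1`):
# all-order block decay on interior windows, finiteness, time-continuity, divergence

HONEST FRAMING (cell `pub-fluidc`, verbatim): *low prior, high value-of-information experiment on Tao's
machine paradigm; NOT a claim that NS blows up.* Support file (successor of `RiccatiInequality(Gen)`, which had the rows
`1 ≤ κ ≤ 5` from THIRD derivatives). For the `Ḣ^s` rates above `s = 5/2` the rows `κ = 2s > 5` are needed; their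
uniform tails come from derivatives of every order:

* `exists_decay` — in the Beale–Kato–Majda class (`HasBoundedSobolevNormsOn (Icc a b) v`, smooth `L²` slices), for
  every `m`: `(2^l)^{m+3} ‖Δ̇_l v(τ)‖₂ ≤ D_m` UNIFORMLY in `τ ∈ [a, b]` and `l ∈ ℤ` (induction: reverse Bernstein
  `2^l a_l(w) ≤ C_r ∑_i a_l(∂_i w)`, the class is stable under `∂_i`, `RiccatiInequalityGen.hasBoundedSobolevNormsOn_fderiv_apply`,
  and the base case `2^{3l} a_l ≤ C_r³ C₂ T₃` from the third derivatives);
* `weighted_sq_le_of_decay`, `tsum_weighted_sq_le_window_add_decay` — with such decay data the row `Y_κ`, `1 ≤ κ ≤ 2N − 1`,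
  is approximated by its symmetric windows up to `2^{−L}(D² + (C₂E₀)²)`;
* along a maximal smooth Leray–Hopf solution of the unforced Navier–Stokes system on `ℝ³` (`ν > 0`):
  `exists_decay_le` (uniform decay data of every order on `[s, t] ⊂ (0, T)`, Tao's persistence of regularity on the
  interior translate), `row_ne_top` (`Y_κ(τ) < ∞` on `(0, T)`, every `κ ≥ 1`), `continuousOn_row` (`Y_κ` continuous on
  interior windows, every `κ ≥ 1`), `row_tendsto_top` / `exists_row_gt` (`Y_κ → ∞` as `t ↑ T` for every `κ > 3`, read off
  `‖u(t)‖_{Ḣ^{κ/2}} → ∞`, `HomSobolevSuperLadder`, through `‖u‖²_{Ḣ^s} ≤ 2·4^s Y_{2s}`).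

0 sorry; no definitions; no named facts.

## References

* T. Tao, Anal. PDE 6 (2013) = arXiv:1108.1165, Cor. 11.1 (persistence of higher regularity). [Tao2011]
* H. Bahouri, J.-Y. Chemin, R. Danchin, Grundlehren 343 (2011), Lemma 2.1 (Bernstein). [BahouriCheminDanchin2011]
-/

noncomputable section

open MeasureTheory Set Function Filter Topology
open scoped ENNReal NNReal
open Literature.Analysis.FluidPDE Literature.Analysis.FunctionSpaces
open Literature.Analysis.FluidPDE.LPBounds (thirdSum eLpNorm_fderiv_blockFn_eq tsum_le_sum_Icc_add_tails)
open Summit.NavierStokesRegularity.FluidComputer.BlockEnergyTransport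
open Summit.NavierStokesRegularity.FluidComputer.BlockEnergyContinuity
open Summit.NavierStokesRegularity.FluidComputer.RiccatiSlice
open Summit.NavierStokesRegularity.FluidComputer.RiccatiInequality
open Summit.NavierStokesRegularity.FluidComputer.RiccatiInequalityGen
open Summit.NavierStokesRegularity.FluidComputer.HomSobolev32Clock

namespace Summit.NavierStokesRegularity.FluidComputer.HighRows

/-! ## All-order block decay in the Beale–Kato–Majda class -/

/-- **All-order block decay, uniformly on a window.** For every `m : ℕ`: if all `L²` Sobolev norms of `τ ↦ v τ` are
bounded on `[a, b]` and the slices are smooth `L²` fields, then there is `D` with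
`(2^l)^{m+3} ‖Δ̇_l v(τ)‖₂ ≤ D` for every `τ ∈ [a, b]` and every `l ∈ ℤ`. Induction on `m`: `m = 0` is
`2^{3l} a_l ≤ C_r³ C₂ T₃` (`RiccatiSlice.two_pow_three_mul_blockL2_le`) with `T₃` uniformly bounded
(`exists_gradSq_thirdSum_le`); the step is reverse Bernstein `2^l a_l(w) ≤ C_r ∑_i ‖Δ̇_l ∂_i w‖₂` and the induction
hypothesis for the derivative fields `∂_i v`, which stay in the class (`hasBoundedSobolevNormsOn_fderiv_apply`).
[cite: BahouriCheminDanchin2011, Lemma 2.1] -/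
theorem exists_decay (m : ℕ) :
    ∀ {a b : ℝ} (v : ℝ → EuclideanSpace ℝ (Fin 3) → EuclideanSpace ℝ (Fin 3)),
      HasBoundedSobolevNormsOn (Icc a b) v → (∀ τ ∈ Icc a b, IsSmoothL2Field (v τ)) →
      ∃ D : ℝ≥0, ∀ τ ∈ Icc a b, ∀ l : ℤ, ((2 : ℝ≥0∞) ^ l) ^ (m + 3) * blockL2 (v τ) l ≤ D := by
  set K := lpBounds (Fin 3) with hK
  induction m with
  | zero =>
    intro a b v hSob hsm
    obtain ⟨_, S₃, hS⟩ := exists_gradSq_thirdSum_le hSob hsm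
    refine ⟨K.Cr ^ 3 * K.C₂ * S₃, fun τ hτ l => ?_⟩
    refine (two_pow_three_mul_blockL2_le (hsm τ hτ) l).trans ?_
    push_cast
    gcongr
    exact (hS τ hτ).2
  | succ m ih =>
    intro a b v hSob hsm
    set e := stdOrthonormalBasis ℝ (EuclideanSpace ℝ (Fin 3)) with he
    have hcd : ∀ τ ∈ Icc a b, ContDiff ℝ ((⊤ : ℕ∞) : WithTop ℕ∞) (v τ) := fun τ hτ => (hsm τ hτ).contDiff
    have hDi : ∀ i, ∃ D : ℝ≥0, ∀ τ ∈ Icc a b, ∀ l : ℤ,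
        ((2 : ℝ≥0∞) ^ l) ^ (m + 3) * blockL2 (fun x => fderiv ℝ (v τ) x (e i)) l ≤ D := fun i =>
      ih (fun τ => fun x => fderiv ℝ (v τ) x (e i))
        (hasBoundedSobolevNormsOn_fderiv_apply hSob hcd (m := e i) (by rw [e.orthonormal.1 i]))
        (fun τ hτ => (hsm τ hτ).fderiv_apply (e i))
    choose D hD using hDi
    refine ⟨K.Cr * ∑ i, D i, fun τ hτ l => ?_⟩
    have hv := hsm τ hτ
    calc ((2 : ℝ≥0∞) ^ l) ^ (m + 1 + 3) * blockL2 (v τ) l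
        = ((2 : ℝ≥0∞) ^ l) ^ (m + 3) * ((2 : ℝ≥0∞) ^ l * blockL2 (v τ) l) := by ring
      _ ≤ ((2 : ℝ≥0∞) ^ l) ^ (m + 3) * (K.Cr * blockGrad (v τ) l) :=
          mul_le_mul' le_rfl (K.two_zpow_mul_blockL2_le hv l)
      _ = K.Cr * ∑ i, ((2 : ℝ≥0∞) ^ l) ^ (m + 3) * blockL2 (fun x => fderiv ℝ (v τ) x (e i)) l := by
          simp only [blockGrad, blockL2, Finset.mul_sum]
          refine Finset.sum_congr rfl fun i _ => ?_
          rw [← eLpNorm_fderiv_blockFn_eq hv l (e i)]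
          ring
      _ ≤ K.Cr * ∑ i, (D i : ℝ≥0∞) := by
          gcongr with i
          exact hD i τ hτ l
      _ = ((K.Cr * ∑ i, D i : ℝ≥0) : ℝ≥0∞) := by push_cast; rfl

/-- A single smooth `L²` field is (trivially) in the Beale–Kato–Majda class on any time set, as a constant family.
[folklore] -/
theorem hasBoundedSobolevNormsOn_const {w : EuclideanSpace ℝ (Fin 3) → EuclideanSpace ℝ (Fin 3)}
    (hw : IsSmoothL2Field w) (S : Set ℝ) : HasBoundedSobolevNormsOn S (fun _ => w) := by
  intro n
  refine ⟨(∫⁻ x, ‖iteratedFDeriv ℝ n w x‖ₑ ^ 2).toNNReal, fun t _ => ?_⟩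
  rw [ENNReal.coe_toNNReal (hw.sobolev n).ne]

/-! ## Windows and tails with decay data -/

/-- **High blocks from decay data**: if `(2^l)^N a_l ≤ D`, `0 ≤ l` and `κ + 1 ≤ 2N`, then
`2^{κl} a_l² ≤ 2^{−l} D²` (`2^{κl} ≤ 2^{(2N−1)l} = 2^{−l}((2^l)^N)²`). [folklore] -/
theorem weighted_sq_le_of_decay {w : EuclideanSpace ℝ (Fin 3) → EuclideanSpace ℝ (Fin 3)} {κ : ℝ} {N : ℕ}
    (hN : κ + 1 ≤ 2 * N) {D : ℝ≥0∞} {l : ℤ} (hl : 0 ≤ l) (hD : ((2 : ℝ≥0∞) ^ l) ^ N * blockL2 w l ≤ D) :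
    (2 : ℝ≥0∞) ^ (κ * (l : ℝ)) * blockL2 w l ^ 2 ≤ ((2 : ℝ≥0∞) ^ l)⁻¹ * D ^ 2 := by
  have h2 : (2 : ℝ≥0∞) ≠ 0 := two_ne_zero
  have h2' : (2 : ℝ≥0∞) ≠ ∞ := ENNReal.ofNat_ne_top
  have hl' : (0 : ℝ) ≤ l := by exact_mod_cast hl
  have hκl : (2 : ℝ≥0∞) ^ (κ * (l : ℝ)) ≤ (2 : ℝ≥0∞) ^ ((2 * (N : ℝ) - 1) * (l : ℝ)) :=
    ENNReal.rpow_le_rpow_of_exponent_le (by norm_num) (mul_le_mul_of_nonneg_right (by linarith) hl')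
  have hsplit : (2 : ℝ≥0∞) ^ ((2 * (N : ℝ) - 1) * (l : ℝ)) = ((2 : ℝ≥0∞) ^ l)⁻¹ * (((2 : ℝ≥0∞) ^ l) ^ N) ^ 2 := by
    rw [show (2 * (N : ℝ) - 1) * (l : ℝ) = ((2 * N : ℕ) : ℝ) * (l : ℝ) + -(l : ℝ) by push_cast; ring,
      RiccatiSummationGen.two_rpow_add, two_rpow_mul_intCast, ENNReal.rpow_natCast, ENNReal.rpow_neg,
      ENNReal.rpow_intCast, pow_mul', mul_comm]
  calc (2 : ℝ≥0∞) ^ (κ * (l : ℝ)) * blockL2 w l ^ 2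
      ≤ (2 : ℝ≥0∞) ^ ((2 * (N : ℝ) - 1) * (l : ℝ)) * blockL2 w l ^ 2 := by gcongr
    _ = ((2 : ℝ≥0∞) ^ l)⁻¹ * (((2 : ℝ≥0∞) ^ l) ^ N * blockL2 w l) ^ 2 := by rw [hsplit]; ring
    _ ≤ ((2 : ℝ≥0∞) ^ l)⁻¹ * D ^ 2 := by gcongr

/-- **Uniform tails of the rows from decay data.** For an `L²` field `w` on `ℝ³` with `(2^l)^N ‖Δ̇_l w‖₂ ≤ D` for
`l ≥ 0`, `‖w‖₂ ≤ E₀`, and a weight `1 ≤ κ ≤ 2N − 1`, for every `L`: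
`∑_l 2^{κl} ‖Δ̇_l w‖₂² ≤ ∑_{|l|≤L} 2^{κl} ‖Δ̇_l w‖₂² + 2^{−L} (D² + (C₂ E₀)²)` (`RiccatiSlice.tsum_weighted_sq_le_window_add`
had `κ ≤ 5`, `D = C_r³C₂S₃`). [folklore] -/
theorem tsum_weighted_sq_le_window_add_decay {w : EuclideanSpace ℝ (Fin 3) → EuclideanSpace ℝ (Fin 3)}
    (hw : MemLp w 2 volume) {κ : ℝ} (hκ1 : 1 ≤ κ) {N : ℕ} (hN : κ + 1 ≤ 2 * N) {D E₀ : ℝ≥0∞}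
    (hD : ∀ l : ℤ, 0 ≤ l → ((2 : ℝ≥0∞) ^ l) ^ N * blockL2 w l ≤ D) (hE₀ : eLpNorm w 2 volume ≤ E₀) (L : ℕ) :
    ∑' l : ℤ, (2 : ℝ≥0∞) ^ (κ * (l : ℝ)) * blockL2 w l ^ 2 ≤
      (∑ l ∈ Finset.Icc (-(L : ℤ)) L, (2 : ℝ≥0∞) ^ (κ * (l : ℝ)) * blockL2 w l ^ 2) +
        (2⁻¹ : ℝ≥0∞) ^ L * (D ^ 2 + ((lpBounds (Fin 3)).C₂ * E₀) ^ 2) := by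
  set K := lpBounds (Fin 3) with hK
  set R₂ : ℝ≥0∞ := (K.C₂ * E₀) ^ 2 with hR₂
  refine (tsum_le_sum_Icc_add_tails _ L).trans ?_
  gcongr
  have hinv : ∀ n : ℕ, ((2 : ℝ≥0∞) ^ ((L : ℤ) + 1 + n))⁻¹ = (2⁻¹ : ℝ≥0∞) ^ (L + 1 + n) := fun n => by
    rw [show ((L : ℤ) + 1 + n) = ((L + 1 + n : ℕ) : ℤ) by push_cast; ring, zpow_natCast, ENNReal.inv_pow]
  have hlow : ∀ n : ℕ, (2 : ℝ≥0∞) ^ (-(L : ℤ) - 1 - n) = (2⁻¹ : ℝ≥0∞) ^ (L + 1 + n) := fun n => by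
    rw [show (-(L : ℤ) - 1 - n) = -((L + 1 + n : ℕ) : ℤ) by push_cast; ring, ENNReal.zpow_neg, zpow_natCast,
      ENNReal.inv_pow]
  have hhi : ∑' n : ℕ, (2 : ℝ≥0∞) ^ (κ * (((L : ℤ) + 1 + n : ℤ) : ℝ)) * blockL2 w ((L : ℤ) + 1 + n) ^ 2 ≤
      (2⁻¹ : ℝ≥0∞) ^ L * D ^ 2 := by
    calc ∑' n : ℕ, (2 : ℝ≥0∞) ^ (κ * (((L : ℤ) + 1 + n : ℤ) : ℝ)) * blockL2 w ((L : ℤ) + 1 + n) ^ 2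
        ≤ ∑' n : ℕ, (2⁻¹ : ℝ≥0∞) ^ (L + 1 + n) * D ^ 2 := by
          refine ENNReal.tsum_le_tsum fun n => ?_
          rw [← hinv n]
          exact weighted_sq_le_of_decay hN (by positivity) (hD _ (by positivity))
      _ = (∑' n : ℕ, (2⁻¹ : ℝ≥0∞) ^ (L + 1 + n)) * D ^ 2 := ENNReal.tsum_mul_right
      _ ≤ (2⁻¹ : ℝ≥0∞) ^ L * D ^ 2 := by
          gcongr
          exact tsum_two_inv_pow_succ_le L
  have hlo : ∑' n : ℕ, (2 : ℝ≥0∞) ^ (κ * (((-(L : ℤ) - 1 - n : ℤ)) : ℝ)) * blockL2 w (-(L : ℤ) - 1 - n) ^ 2 ≤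
      (2⁻¹ : ℝ≥0∞) ^ L * R₂ := by
    calc ∑' n : ℕ, (2 : ℝ≥0∞) ^ (κ * (((-(L : ℤ) - 1 - n : ℤ)) : ℝ)) * blockL2 w (-(L : ℤ) - 1 - n) ^ 2
        ≤ ∑' n : ℕ, (2⁻¹ : ℝ≥0∞) ^ (L + 1 + n) * ((K.C₂ * eLpNorm w 2 volume) ^ 2) := by
          refine ENNReal.tsum_le_tsum fun n => ?_
          rw [← hlow n]
          exact weighted_sq_le_of_nonpos hw hκ1 (by omega)
      _ = (∑' n : ℕ, (2⁻¹ : ℝ≥0∞) ^ (L + 1 + n)) * (K.C₂ * eLpNorm w 2 volume) ^ 2 := ENNReal.tsum_mul_right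
      _ ≤ (2⁻¹ : ℝ≥0∞) ^ L * R₂ := by
          rw [hR₂]
          gcongr
          exact tsum_two_inv_pow_succ_le L
  calc (∑' n : ℕ, (2 : ℝ≥0∞) ^ (κ * (((L : ℤ) + 1 + n : ℤ) : ℝ)) * blockL2 w ((L : ℤ) + 1 + n) ^ 2) +
        ∑' n : ℕ, (2 : ℝ≥0∞) ^ (κ * (((-(L : ℤ) - 1 - n : ℤ)) : ℝ)) * blockL2 w (-(L : ℤ) - 1 - n) ^ 2
      ≤ (2⁻¹ : ℝ≥0∞) ^ L * D ^ 2 + (2⁻¹ : ℝ≥0∞) ^ L * R₂ := add_le_add hhi hlo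
    _ = (2⁻¹ : ℝ≥0∞) ^ L * (D ^ 2 + R₂) := (mul_add _ _ _).symm

/-- The weight condition: with `N = ⌈κ⌉₊ + 3`, `κ + 1 ≤ 2N`. [folklore] -/
theorem weight_le_two_mul_ceil (κ : ℝ) : κ + 1 ≤ 2 * ((⌈κ⌉₊ + 3 : ℕ) : ℝ) := by
  have h := Nat.le_ceil κ
  push_cast
  linarith

/-! ## Along a maximal solution: decay data, finiteness, continuity -/

/-- **Uniform decay data of every order on an interior window.** For a maximal smooth solution `(u, p)` of the unforced
system on `ℝ³ × [0, T)` (`ν > 0`), Leray–Hopf from `u 0`, `0 < s ≤ t < T` and every `m`: there are `D, E₀` with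
`(2^l)^{m+3} ‖Δ̇_l u(τ)‖₂ ≤ D` for all `l` and `‖u(τ)‖₂ ≤ E₀`, for every `τ ∈ [s, t]` — the interior translate
`u(· + s)` lies in the Beale–Kato–Majda class on `[0, t − s]` (`GeometricFace.hasBoundedSobolevNormsOn_translate`) and
`exists_decay` applies. [cite: Tao2011, Cor. 11.1] -/
theorem exists_decay_le (m : ℕ) {ν T : ℝ} (hν : 0 < ν) (hT : 0 < T)
    {u : ℝ → EuclideanSpace ℝ (Fin 3) → EuclideanSpace ℝ (Fin 3)} {p : ℝ → EuclideanSpace ℝ (Fin 3) → ℝ}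
    (hmax : IsMaximalSmoothSolution ν 0 u p T) (hLH : IsLerayHopfOn T ν 0 (u 0) u)
    {s t : ℝ} (hs : 0 < s) (hst : s ≤ t) (htT : t < T) :
    ∃ D E₀ : ℝ≥0, ∀ τ ∈ Icc s t,
      (∀ l : ℤ, ((2 : ℝ≥0∞) ^ l) ^ (m + 3) * blockL2 (u τ) l ≤ D) ∧ eLpNorm (u τ) 2 volume ≤ E₀ := by
  have hsI : s ∈ Ioo 0 T := ⟨hs, hst.trans_lt htT⟩
  have hSob := GeometricFace.hasBoundedSobolevNormsOn_translate hν hT hmax hLH hsI (T'' := t - s) (by linarith)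
  have hsm : ∀ τ ∈ Icc 0 (t - s), IsSmoothL2Field ((fun τ' => u (τ' + s)) τ) := fun τ hτ =>
    isSmoothL2Field_slice_of_maximal hν hT hmax hLH ⟨by linarith [hτ.1], by linarith [hτ.2]⟩
  obtain ⟨D, hD⟩ := exists_decay m (fun τ' => u (τ' + s)) hSob hsm
  obtain ⟨E₀, hE₀⟩ := exists_eLpNorm_slice_le hLH hν.le
  refine ⟨D, E₀, fun τ hτ => ⟨fun l => ?_, hE₀ τ ⟨(hs.trans_le hτ.1).le, (hτ.2.trans_lt htT).le⟩⟩⟩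
  have h := hD (τ - s) ⟨by linarith [hτ.1], by linarith [hτ.2]⟩ l
  simpa only [sub_add_cancel] using h

/-- **Every row is finite on the open lifespan**: `∑_j 2^{κj} ‖Δ̇_j u(τ)‖₂² < ∞` for `τ ∈ (0, T)` and every `κ ≥ 1`
(decay data of order `⌈κ⌉₊ + 3` at the single time `τ`). [folklore] -/
theorem row_ne_top {κ : ℝ} (hκ1 : 1 ≤ κ) {ν T : ℝ} (hν : 0 < ν) (hT : 0 < T)
    {u : ℝ → EuclideanSpace ℝ (Fin 3) → EuclideanSpace ℝ (Fin 3)} {p : ℝ → EuclideanSpace ℝ (Fin 3) → ℝ}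
    (hmax : IsMaximalSmoothSolution ν 0 u p T) (hLH : IsLerayHopfOn T ν 0 (u 0) u) {τ : ℝ} (hτ : τ ∈ Ioo 0 T) :
    ∑' j : ℤ, (2 : ℝ≥0∞) ^ (κ * (j : ℝ)) * blockL2 (u τ) j ^ 2 ≠ ∞ := by
  obtain ⟨D, E₀, hDE⟩ := exists_decay_le ⌈κ⌉₊ hν hT hmax hLH hτ.1 le_rfl hτ.2
  have hw : IsSmoothL2Field (u τ) := isSmoothL2Field_slice_of_maximal hν hT hmax hLH hτ
  obtain ⟨hD, hE⟩ := hDE τ ⟨le_rfl, le_rfl⟩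
  have h := tsum_weighted_sq_le_window_add_decay hw.memLp_two hκ1 (weight_le_two_mul_ceil κ)
    (D := (D : ℝ≥0∞)) (E₀ := (E₀ : ℝ≥0∞)) (fun l _ => hD l) hE 0
  refine ne_top_of_le_ne_top ?_ h
  refine ENNReal.add_ne_top.2 ⟨?_, ?_⟩
  · exact ENNReal.sum_ne_top.2 fun l _ => ENNReal.mul_ne_top (RiccatiSlice.two_rpow_ne_top _)
      (ENNReal.pow_ne_top ((hw.blockFn l).memLp_two).eLpNorm_ne_top)
  · exact ENNReal.mul_ne_top (ENNReal.pow_ne_top (by norm_num))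
      (ENNReal.add_ne_top.2 ⟨ENNReal.pow_ne_top ENNReal.coe_ne_top,
        ENNReal.pow_ne_top (ENNReal.mul_ne_top ENNReal.coe_ne_top ENNReal.coe_ne_top)⟩)

/-- **Time-continuity of every row on interior windows**: for `κ ≥ 1`, `τ ↦ ∑_j 2^{κj} ‖Δ̇_j u(τ)‖₂²` (as a real
number) is continuous on every `[s, t] ⊂ (0, T)` along a maximal smooth Leray–Hopf solution — the windows are continuous
(`BlockEnergyContinuity.continuousOn_blockL2_sq`) and converge uniformly by `tsum_weighted_sq_le_window_add_decay` with
the uniform decay data of `exists_decay_le` (`RiccatiInequalityGen.continuousOn_row` is the case `κ ≤ 5`). [folklore] -/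
theorem continuousOn_row {κ : ℝ} (hκ1 : 1 ≤ κ) {ν T : ℝ} (hν : 0 < ν) (hT : 0 < T)
    {u : ℝ → EuclideanSpace ℝ (Fin 3) → EuclideanSpace ℝ (Fin 3)} {p : ℝ → EuclideanSpace ℝ (Fin 3) → ℝ}
    (hmax : IsMaximalSmoothSolution ν 0 u p T) (hLH : IsLerayHopfOn T ν 0 (u 0) u)
    {s t : ℝ} (hs : 0 < s) (hst : s ≤ t) (htT : t < T) :
    ContinuousOn (fun τ => (∑' j : ℤ, (2 : ℝ≥0∞) ^ (κ * (j : ℝ)) * blockL2 (u τ) j ^ 2).toReal) (Icc s t) := by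
  set K := lpBounds (Fin 3) with hK
  obtain ⟨D, E₀, hDE⟩ := exists_decay_le ⌈κ⌉₊ hν hT hmax hLH hs hst htT
  set W : ℤ → ℝ≥0∞ := fun j => (2 : ℝ≥0∞) ^ (κ * (j : ℝ)) with hW
  set R : ℝ≥0∞ := (D : ℝ≥0∞) ^ 2 + (K.C₂ * E₀) ^ 2 with hR
  set Y : ℝ → ℝ := fun τ => (∑' j : ℤ, W j * blockL2 (u τ) j ^ 2).toReal with hY
  set F : ℕ → ℝ → ℝ := fun L τ => ∑ j ∈ Finset.Icc (-(L : ℤ)) L, (W j * blockL2 (u τ) j ^ 2).toReal with hF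
  have hsub : Icc s t ⊆ Ioo 0 T := fun τ hτ => ⟨hs.trans_le hτ.1, hτ.2.trans_lt htT⟩
  have hw : ∀ τ ∈ Icc s t, IsSmoothL2Field (u τ) := fun τ hτ =>
    isSmoothL2Field_slice_of_maximal hν hT hmax hLH (hsub hτ)
  have hWtop : ∀ j, W j ≠ ∞ := fun j => RiccatiSlice.two_rpow_ne_top _
  have haj : ∀ τ ∈ Icc s t, ∀ j, blockL2 (u τ) j ^ 2 ≠ ∞ := fun τ hτ j =>
    ENNReal.pow_ne_top (((hw τ hτ).blockFn j).memLp_two).eLpNorm_ne_top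
  have hRtop : R ≠ ∞ := ENNReal.add_ne_top.2 ⟨ENNReal.pow_ne_top ENNReal.coe_ne_top,
    ENNReal.pow_ne_top (ENNReal.mul_ne_top ENNReal.coe_ne_top ENNReal.coe_ne_top)⟩
  have hytop : ∀ τ ∈ Icc s t, ∑' j : ℤ, W j * blockL2 (u τ) j ^ 2 ≠ ∞ := fun τ hτ =>
    row_ne_top hκ1 hν hT hmax hLH (hsub hτ)
  have hFc : ∀ L, ContinuousOn (F L) (Icc s t) := by
    intro L
    refine continuousOn_finsetSum _ fun j _ => ?_
    have h1 : ContinuousOn (fun τ => W j * blockL2 (u τ) j ^ 2) (Icc s t) :=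
      (ENNReal.continuous_const_mul (hWtop j)).comp_continuousOn
        ((continuousOn_blockL2_sq hν hT hmax hLH j).mono hsub)
    exact ENNReal.continuousOn_toReal.comp h1 fun τ hτ => ENNReal.mul_ne_top (hWtop j) (haj τ hτ j)
  have hclose : ∀ L τ, τ ∈ Icc s t → dist (Y τ) (F L τ) ≤ ((2⁻¹ : ℝ≥0∞) ^ L * R).toReal := by
    intro L τ hτ
    set yL : ℝ≥0∞ := ∑ j ∈ Finset.Icc (-(L : ℤ)) L, W j * blockL2 (u τ) j ^ 2 with hyL
    have hyLtop : yL ≠ ∞ := ENNReal.sum_ne_top.2 fun j _ => ENNReal.mul_ne_top (hWtop j) (haj τ hτ j)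
    have hFL : F L τ = yL.toReal := by
      rw [hyL, ENNReal.toReal_sum fun j _ => ENNReal.mul_ne_top (hWtop j) (haj τ hτ j)]
    have hlow : yL ≤ ∑' j : ℤ, W j * blockL2 (u τ) j ^ 2 := ENNReal.sum_le_tsum _
    have hup : ∑' j : ℤ, W j * blockL2 (u τ) j ^ 2 ≤ yL + (2⁻¹ : ℝ≥0∞) ^ L * R :=
      tsum_weighted_sq_le_window_add_decay (hw τ hτ).memLp_two hκ1 (weight_le_two_mul_ceil κ)
        (D := (D : ℝ≥0∞)) (E₀ := (E₀ : ℝ≥0∞)) (fun l _ => (hDE τ hτ).1 l) (hDE τ hτ).2 L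
    have h1 : yL.toReal ≤ Y τ := ENNReal.toReal_mono (hytop τ hτ) hlow
    have h2 : Y τ ≤ yL.toReal + ((2⁻¹ : ℝ≥0∞) ^ L * R).toReal := by
      rw [hY]
      simp only
      rw [← ENNReal.toReal_add hyLtop (ENNReal.mul_ne_top (ENNReal.pow_ne_top (by norm_num)) hRtop)]
      exact ENNReal.toReal_mono (ENNReal.add_ne_top.2 ⟨hyLtop,
        ENNReal.mul_ne_top (ENNReal.pow_ne_top (by norm_num)) hRtop⟩) hup
    rw [hFL, Real.dist_eq, abs_of_nonneg (by linarith)]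
    linarith
  have hρ : Tendsto (fun L : ℕ => ((2⁻¹ : ℝ≥0∞) ^ L * R).toReal) atTop (𝓝 0) := by
    have h4 : Tendsto (fun L : ℕ => (2⁻¹ : ℝ≥0∞) ^ L) atTop (𝓝 0) :=
      ENNReal.tendsto_pow_atTop_nhds_zero_of_lt_one (by norm_num)
    have h5 := ENNReal.Tendsto.mul_const h4 (Or.inr hRtop)
    rw [zero_mul] at h5
    have h6 := (ENNReal.tendsto_toReal ENNReal.zero_ne_top).comp h5
    rwa [ENNReal.toReal_zero] at h6
  have hunif : TendstoUniformlyOn F Y atTop (Icc s t) := by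
    refine Metric.tendstoUniformlyOn_iff.2 fun ε hε => ?_
    filter_upwards [(tendsto_order.1 hρ).2 ε hε] with L hL τ hτ
    exact (hclose L τ hτ).trans_lt hL
  exact hunif.continuousOn (Eventually.of_forall hFc).frequently

/-! ## Divergence of every row above `κ = 3` -/

/-- **Every row `κ > 3` diverges at the lifespan**: `∑_j 2^{κj} ‖Δ̇_j u(t)‖₂² → ∞` as `t ↑ T` along every maximal smooth
Leray–Hopf solution of the unforced system (`ν > 0`) — `‖u(t)‖_{Ḣ^{κ/2}} → ∞`
(`HomSobolevSuperLadder.homSobolev_superLadder_tendsto_top`) and `‖u‖²_{Ḣ^s} ≤ 2·4^s ∑_j 4^{sj} a_j²`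
(`HomSobolev32Clock.eHomSobolevSeminorm_sq_le_tsum_weight_blockL2`). No rate here; the rates are L58 (`κ < 5`) and the
successor file (`κ > 5`). [cite: Benameur2010, Thm. 1.1] -/
theorem row_tendsto_top {κ : ℝ} (hκ : 3 < κ) {ν T : ℝ} (hν : 0 < ν) (hT : 0 < T)
    {u : ℝ → EuclideanSpace ℝ (Fin 3) → EuclideanSpace ℝ (Fin 3)} {p : ℝ → EuclideanSpace ℝ (Fin 3) → ℝ}
    (hmax : IsMaximalSmoothSolution ν 0 u p T) (hLH : IsLerayHopfOn T ν 0 (u 0) u) :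
    Tendsto (fun t => ∑' j : ℤ, (2 : ℝ≥0∞) ^ (κ * (j : ℝ)) * blockL2 (u t) j ^ 2) (𝓝[<] T) (𝓝 ∞) := by
  have hσ : 3 / 2 < κ / 2 := by linarith
  set M : ℝ≥0∞ := 2 * (2 : ℝ≥0∞) ^ |κ| with hM
  have hMtop : M ≠ ∞ := ENNReal.mul_ne_top (by norm_num) (RiccatiSlice.two_rpow_ne_top _)
  have h := HomSobolevSuperLadder.homSobolev_superLadder_tendsto_top (κ / 2) hσ hν hT hmax hLH
  rw [ENNReal.tendsto_nhds_top_iff_nnreal] at h ⊢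
  intro x
  filter_upwards [h (max (M.toNNReal * x) 1), Ioo_mem_nhdsLT hT] with t ht htI
  have hut : MemLp (u t) 2 volume := hLH.memLp t ⟨htI.1.le, htI.2.le⟩
  have hcmp := eHomSobolevSeminorm_sq_le_tsum_weight_blockL2 (κ / 2) hut
  rw [show (2 : ℝ) * (κ / 2) = κ by ring] at hcmp
  set N : ℝ≥0∞ := Function.eHomSobolevSeminorm (κ / 2) (⇑EuclideanSpace.complexify ∘ u t) with hN
  have h1 : (1 : ℝ≥0∞) ≤ N := le_of_lt (lt_of_le_of_lt (by exact_mod_cast le_max_right _ _) ht)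
  have h2 : ((M.toNNReal * x : ℝ≥0) : ℝ≥0∞) < N := lt_of_le_of_lt (by exact_mod_cast le_max_left _ _) ht
  have h3 : N ≤ N ^ 2 := by rw [sq]; exact le_mul_of_one_le_left zero_le h1
  have h4 : M * x < M * ∑' j : ℤ, (2 : ℝ≥0∞) ^ (κ * (j : ℝ)) * blockL2 (u t) j ^ 2 :=
    calc M * x = ((M.toNNReal * x : ℝ≥0) : ℝ≥0∞) := by rw [ENNReal.coe_mul, ENNReal.coe_toNNReal hMtop]
      _ < N := h2
      _ ≤ N ^ 2 := h3
      _ ≤ M * ∑' j : ℤ, (2 : ℝ≥0∞) ^ (κ * (j : ℝ)) * blockL2 (u t) j ^ 2 := hcmp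
  exact lt_of_mul_lt_mul_left h4 zero_le

/-- **Every row `κ > 3` is unbounded on every terminal window** (finite values): for `t₀ < T` and every real `M`
there is `b ∈ (t₀, T) ∩ (0, T)` with `M < (∑_j 2^{κj} ‖Δ̇_j u(b)‖₂²).toReal` (`OptimalSobolevClock.exists_row_gt` is
`2 ≤ κ ≤ 5`). [cite: Benameur2010, Thm. 1.1] -/
theorem exists_row_gt {κ : ℝ} (hκ : 3 < κ) {ν T : ℝ} (hν : 0 < ν) (hT : 0 < T)
    {u : ℝ → EuclideanSpace ℝ (Fin 3) → EuclideanSpace ℝ (Fin 3)} {p : ℝ → EuclideanSpace ℝ (Fin 3) → ℝ}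
    (hmax : IsMaximalSmoothSolution ν 0 u p T) (hLH : IsLerayHopfOn T ν 0 (u 0) u)
    {t₀ : ℝ} (ht₀ : t₀ < T) (M : ℝ) :
    ∃ b ∈ Ioo (max t₀ 0) T,
      M < (∑' j : ℤ, (2 : ℝ≥0∞) ^ (κ * (j : ℝ)) * blockL2 (u b) j ^ 2).toReal := by
  have h := row_tendsto_top hκ hν hT hmax hLH
  rw [ENNReal.tendsto_nhds_top_iff_nnreal] at h
  have hev := (h M.toNNReal).and (Ioo_mem_nhdsLT (max_lt ht₀ hT) : Ioo (max t₀ 0) T ∈ 𝓝[<] T)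
  obtain ⟨b, hb, hbI⟩ := hev.exists
  refine ⟨b, hbI, ?_⟩
  have htop := row_ne_top (κ := κ) (by linarith) hν hT hmax hLH ⟨(le_max_right _ _).trans_lt hbI.1, hbI.2⟩
  have h1 := ENNReal.toReal_strict_mono htop hb
  rw [ENNReal.coe_toReal] at h1
  exact lt_of_le_of_lt (Real.le_coe_toNNReal M) h1

end Summit.NavierStokesRegularity.FluidComputer.HighRows

end
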